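import Mathlib
import Summits.Ventures.PercRepro2.Defs
import Summits.Ventures.PercRepro2.Independence
import Summits.Ventures.PercRepro2.Harris
import Summits.Ventures.PercRepro2.Graph
import Summits.Ventures.PercRepro2.Events
import Summits.Ventures.PercRepro2.PartitionThree
import Summits.Ventures.PercRepro2.BHKAvoid
import Summits.Ventures.PercRepro2.BHKOutside
import Summits.Ventures.PercRepro2.ZCTwoEdge
import Summits.Ventures.PercRepro2.ZCTwoEdgeGraph
import Summits.Ventures.PercRepro2.ZCA3WGraph

/-!
# Theorem I on the graph — the structural lemmas (blind cell PercRepro2, mine-a g25; MINE-A.md §74.6)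
The facts that `zc_oa3w_graph` (`ZCOA3WGraph`) feeds to the abstract theorem `zc_oa3w`, in the events of
`G − o` (`ω⁻ := ω[f₁, f₂ ↦ closed]`; `f₁ = oa₃`, `f₂ = ow` the only edges at `o`): the cluster of a vertex
not connected to `o`; the root cluster event of `G` over the four states of `(f₁, f₂)` (`oa3w_U_eq`);
lemma (P1) for `(a₁, a₃, w)` under `p[f₁, f₂ ↦ 0]` (`oa3w_P1`); the inductive hypothesis shifted to `G`
(`oa3w_ZC_shift`); `bhk_inside_outside_avoid` for the root avoiding `{a₃}` / `{a₃, w}` with the outside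
connection `a₃ ↔ w` (`oa3w_NA_single` / `oa3w_NA_two`).  One seat.
-/

namespace Summit.Ventures.PercRepro2
section GraphTheoremIAux
variable {V : Type*} [DecidableEq V] {E : Type*} [Fintype E] [DecidableEq E] {R : Type*} [CommRing R]
  [LinearOrder R] [IsStrictOrderedRing R]

omit [DecidableEq V] [Fintype E] in
/-- If `x` is not connected to the degree-two vertex `v` (edges `f₁`, `f₂`), its cluster is its
cluster with `f₁`, `f₂` closed. -/
lemma cluster_eq_closeTwo_of_not_conn_far {ends : E → Sym2 V} {v y z x : V} {f₁ f₂ : E}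
    (hf : f₁ ≠ f₂) (hends₁ : ends f₁ = s(v, y)) (hends₂ : ends f₂ = s(v, z))
    (hmark : ∀ e, v ∈ ends e → e = f₁ ∨ e = f₂) (hx : x ≠ v) {ω : Config E}
    (hno : ¬ Conn ends ω x v) :
    cluster ends ω x = cluster ends (Function.update (Function.update ω f₁ false) f₂ false) x := by
  apply Set.Subset.antisymm
  · intro u hu
    have h1 : ω f₁ = true → y ∉ cluster ends (Function.update (Function.update ω f₁ false) f₂ false) x := by
      intro h1 hy
      have hvy : Conn ends ω v y := conn_of_openAdj ⟨f₁, h1, hends₁⟩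
      have hxy : Conn ends ω x y := conn_mono (closeTwo_le f₁ f₂ ω) hy
      exact hno (conn_trans hxy (conn_symm hvy))
    have h2 : ω f₂ = true → z ∉ cluster ends (Function.update (Function.update ω f₁ false) f₂ false) x := by
      intro h2 hz
      have hvz : Conn ends ω v z := conn_of_openAdj ⟨f₂, h2, hends₂⟩
      have hxz : Conn ends ω x z := conn_mono (closeTwo_le f₁ f₂ ω) hz
      exact hno (conn_trans hxz (conn_symm hvz))
    exact mem_cluster_closeTwo_of_conn hf hends₁ hends₂ hmark hx h1 h2 hu
  · exact cluster_mono (closeTwo_le f₁ f₂ ω) x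

omit [DecidableEq V] [Fintype E] in
/-- The cluster event `{C(a₁) ∈ 𝓔}` of `G` in terms of the events of `G − o` (the `U` identity of
Theorem I's graph instance). -/
lemma oa3w_U_eq {ends : E → Sym2 V} {a₁ a₃ o w : V} {f₁ f₂ : E} (hf : f₁ ≠ f₂)
    (hends₁ : ends f₁ = s(o, a₃)) (hends₂ : ends f₂ = s(o, w))
    (hmark : ∀ e, o ∈ ends e → e = f₁ ∨ e = f₂) (ho1 : o ≠ a₁) (𝓔 : Set (Set V)) :
    clusterInEvent ends a₁ 𝓔 = (openEdge f₁ ∩ openEdge f₂ ∩ ({ω : Config E | Conn ends (Function.update (Function.update ω f₁ false) f₂ false) a₁ a₃}) ∩ ({ω : Config E | Conn ends (Function.update (Function.update ω f₁ false) f₂ false) a₁ w})ᶜ ∩ ({ω : Config E | {o} ∪ cluster ends (Function.update (Function.update ω f₁ false) f₂ false) a₁ ∪ cluster ends (Function.update (Function.update ω f₁ false) f₂ false) w ∈ 𝓔})) ∪ (openEdge f₁ ∩ openEdge f₂ ∩ ({ω : Config E | Conn ends (Function.update (Function.update ω f₁ false) f₂ false) a₁ a₃})ᶜ ∩ ({ω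 : Config E | Conn ends (Function.update (Function.update ω f₁ false) f₂ false) a₁ w}) ∩ ({ω : Config E | {o} ∪ cluster ends (Function.update (Function.update ω f₁ false) f₂ false) a₁ ∪ cluster ends (Function.update (Function.update ω f₁ false) f₂ false) a₃ ∈ 𝓔}))
      ∪ (((openEdge f₁ ∩ ({ω : Config E | Conn ends (Function.update (Function.update ω f₁ false) f₂ false) a₁ a₃})) ∪ (openEdge f₂ ∩ ({ω : Config E | Conn ends (Function.update (Function.update ω f₁ false) f₂ false) a₁ w}))) ∩ (openEdge f₁ ∩ openEdge f₂ ∩ ((({ω : Config E | Conn ends (Function.update (Function.update ω f₁ false) f₂ false) a₁ a₃}) ∩ ({ω : Config E | Conn ends (Function.update (Function.update ω f₁ false) f₂ false) a₁ w})ᶜ) ∪ (({ω : Config E | Conn ends (Function.update (Function.update ω f₁ false) f₂ false) a₁ a₃})ᶜ ∩ ({ω : Config E | Conn ends (Function.update (Function.update ω f₁ false) f₂ false) a₁ w}))))ᶜ ∩ ({ω : Config E | {o} ∪ cluster ends (Function.update (Function.update ω f₁ false) f₂ false) a₁ ∈ 𝓔})) ∪ (((openEdge f₁ ∩ ({ω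 : Config E | Conn ends (Function.update (Function.update ω f₁ false) f₂ false) a₁ a₃})) ∪ (openEdge f₂ ∩ ({ω : Config E | Conn ends (Function.update (Function.update ω f₁ false) f₂ false) a₁ w})))ᶜ ∩ ({ω : Config E | cluster ends (Function.update (Function.update ω f₁ false) f₂ false) a₁ ∈ 𝓔})) := by
  set A : Set (Config E) := {ω | Conn ends (Function.update (Function.update ω f₁ false) f₂ false) a₁ a₃} with hAdef
  set W : Set (Config E) := {ω | Conn ends (Function.update (Function.update ω f₁ false) f₂ false) a₁ w} with hWdef
  set Γ : Set (Config E) := {ω | Conn ends (Function.update (Function.update ω f₁ false) f₂ false) a₃ w} with hΓdef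
  set X₀ : Set (Config E) := {ω | cluster ends (Function.update (Function.update ω f₁ false) f₂ false) a₁ ∈ 𝓔} with hX₀def
  set X₁ : Set (Config E) := {ω | {o} ∪ cluster ends (Function.update (Function.update ω f₁ false) f₂ false) a₁ ∈ 𝓔} with hX₁def
  set X₂ : Set (Config E) := {ω | {o} ∪ cluster ends (Function.update (Function.update ω f₁ false) f₂ false) a₁
      ∪ cluster ends (Function.update (Function.update ω f₁ false) f₂ false) w ∈ 𝓔} with hX₂def
  set X₃ : Set (Config E) := {ω | {o} ∪ cluster ends (Function.update (Function.update ω f₁ false) f₂ false) a₁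
      ∪ cluster ends (Function.update (Function.update ω f₁ false) f₂ false) a₃ ∈ 𝓔} with hX₃def
  set X₄ : Set (Config E) := {ω | {o} ∪ cluster ends (Function.update (Function.update ω f₁ false) f₂ false) a₁
      ∪ cluster ends (Function.update (Function.update ω f₁ false) f₂ false) a₃
      ∪ cluster ends (Function.update (Function.update ω f₁ false) f₂ false) w ∈ 𝓔} with hX₄def
  have hconn : ∀ ω : Config E, Conn ends ω a₁ o ↔ (ω f₁ = true ∧ ω ∈ A) ∨ (ω f₂ = true ∧ ω ∈ W) := by
    intro ω
    have h := conn_a3_o_iff_w (a₃ := o) (a₁ := a₃) (w := w) (o := a₁) hf hends₁ hends₂ hmark ho1 ω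
    simp only [A, W, Set.mem_setOf_eq]
    constructor
    · intro hc
      rcases h.1 (conn_symm hc) with ⟨h1, h2⟩ | ⟨h1, h2⟩
      · exact Or.inl ⟨h1, conn_symm h2⟩
      · exact Or.inr ⟨h1, conn_symm h2⟩
    · intro hc
      rcases hc with ⟨h1, h2⟩ | ⟨h1, h2⟩
      · exact conn_symm (h.2 (Or.inl ⟨h1, conn_symm h2⟩))
      · exact conn_symm (h.2 (Or.inr ⟨h1, conn_symm h2⟩))

  ext ω
  simp only [mem_clusterInEvent]
  by_cases h3 : Conn ends ω a₁ o
  · have h3' := (hconn ω).1 h3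
    have hcl : cluster ends ω a₁ = {o} ∪ {u | ω f₁ = true ∧ u ∈ cluster ends (Function.update (Function.update ω f₁ false) f₂ false) a₃}
        ∪ {u | ω f₂ = true ∧ u ∈ cluster ends (Function.update (Function.update ω f₁ false) f₂ false) w} := by
      rw [cluster_eq_of_conn h3]
      exact cluster_root_eq (a₁ := o) (a₃ := a₃) (o := w) hf hends₁ hends₂ hmark ω
    rcases Bool.eq_false_or_eq_true (ω f₁) with hf1 | hf1 <;>
      rcases Bool.eq_false_or_eq_true (ω f₂) with hf2 | hf2
    · -- both open
      by_cases hA' : ω ∈ A <;> by_cases hW' : ω ∈ W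
      · have hca : cluster ends (Function.update (Function.update ω f₁ false) f₂ false) a₃
            = cluster ends (Function.update (Function.update ω f₁ false) f₂ false) a₁ :=
          (cluster_eq_of_conn hA').symm
        have hcw : cluster ends (Function.update (Function.update ω f₁ false) f₂ false) w
            = cluster ends (Function.update (Function.update ω f₁ false) f₂ false) a₁ :=
          (cluster_eq_of_conn hW').symm
        have hcl' : cluster ends ω a₁ = {o} ∪ cluster ends (Function.update (Function.update ω f₁ false) f₂ false) a₁ := by
          rw [hcl, hca, hcw]; ext u
          simp only [Set.mem_union, Set.mem_setOf_eq, hf1, hf2, true_and]; tauto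
        have key : cluster ends ω a₁ ∈ 𝓔 ↔ ω ∈ X₁ := by rw [hcl']; exact Iff.rfl
        rw [key]
        simp [hf1, hf2, hA', hW']
      · have hca : cluster ends (Function.update (Function.update ω f₁ false) f₂ false) a₃
            = cluster ends (Function.update (Function.update ω f₁ false) f₂ false) a₁ :=
          (cluster_eq_of_conn hA').symm
        have hcl' : cluster ends ω a₁ = {o} ∪ cluster ends (Function.update (Function.update ω f₁ false) f₂ false) a₁
            ∪ cluster ends (Function.update (Function.update ω f₁ false) f₂ false) w := by
          rw [hcl, hca]; ext u
          simp only [Set.mem_union, Set.mem_setOf_eq, hf1, hf2, true_and]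
        have key : cluster ends ω a₁ ∈ 𝓔 ↔ ω ∈ X₂ := by rw [hcl']; exact Iff.rfl
        rw [key]
        simp [hf1, hf2, hA', hW']
      · have hcw : cluster ends (Function.update (Function.update ω f₁ false) f₂ false) w
            = cluster ends (Function.update (Function.update ω f₁ false) f₂ false) a₁ :=
          (cluster_eq_of_conn hW').symm
        have hcl' : cluster ends ω a₁ = {o} ∪ cluster ends (Function.update (Function.update ω f₁ false) f₂ false) a₁
            ∪ cluster ends (Function.update (Function.update ω f₁ false) f₂ false) a₃ := by
          rw [hcl, hcw]; ext u
          simp only [Set.mem_union, Set.mem_setOf_eq, hf1, hf2, true_and]; tauto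
        have key : cluster ends ω a₁ ∈ 𝓔 ↔ ω ∈ X₃ := by rw [hcl']; exact Iff.rfl
        rw [key]
        simp [hf1, hf2, hA', hW']
      · exfalso
        rcases h3' with ⟨_, h⟩ | ⟨_, h⟩
        · exact hA' h
        · exact hW' h
    · -- `f₁` open, `f₂` closed
      have hA' : ω ∈ A := by
        rcases h3' with ⟨_, h⟩ | ⟨h, _⟩
        · exact h
        · rw [hf2] at h; exact absurd h Bool.false_ne_true
      have hca : cluster ends (Function.update (Function.update ω f₁ false) f₂ false) a₃
          = cluster ends (Function.update (Function.update ω f₁ false) f₂ false) a₁ :=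
        (cluster_eq_of_conn hA').symm
      have hcl' : cluster ends ω a₁ = {o} ∪ cluster ends (Function.update (Function.update ω f₁ false) f₂ false) a₁ := by
        rw [hcl, hca]; ext u
        simp [hf1, hf2]
      have key : cluster ends ω a₁ ∈ 𝓔 ↔ ω ∈ X₁ := by rw [hcl']; exact Iff.rfl
      rw [key]
      simp [hf1, hf2, hA']
    · -- `f₁` closed, `f₂` open
      have hW' : ω ∈ W := by
        rcases h3' with ⟨h, _⟩ | ⟨_, h⟩
        · rw [hf1] at h; exact absurd h Bool.false_ne_true
        · exact h
      have hcw : cluster ends (Function.update (Function.update ω f₁ false) f₂ false) w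
          = cluster ends (Function.update (Function.update ω f₁ false) f₂ false) a₁ :=
        (cluster_eq_of_conn hW').symm
      have hcl' : cluster ends ω a₁ = {o} ∪ cluster ends (Function.update (Function.update ω f₁ false) f₂ false) a₁ := by
        rw [hcl, hcw]; ext u
        simp [hf1, hf2]
      have key : cluster ends ω a₁ ∈ 𝓔 ↔ ω ∈ X₁ := by rw [hcl']; exact Iff.rfl
      rw [key]
      simp [hf1, hf2, hW']
    · exfalso
      rcases h3' with ⟨h, _⟩ | ⟨h, _⟩
      · rw [hf1] at h; exact Bool.false_ne_true h
      · rw [hf2] at h; exact Bool.false_ne_true h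
  · have hnot : ¬ ((ω f₁ = true ∧ ω ∈ A) ∨ (ω f₂ = true ∧ ω ∈ W)) := fun h => h3 ((hconn ω).2 h)
    have key : cluster ends ω a₁ ∈ 𝓔 ↔ ω ∈ X₀ := by
      rw [cluster_eq_closeTwo_of_not_conn_far hf hends₁ hends₂ hmark (Ne.symm ho1) h3]; exact Iff.rfl
    rw [key]
    rcases Bool.eq_false_or_eq_true (ω f₁) with hf1 | hf1 <;>
      rcases Bool.eq_false_or_eq_true (ω f₂) with hf2 | hf2
    · have hnA : ω ∉ A := fun h => hnot (Or.inl ⟨hf1, h⟩)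
      have hnW : ω ∉ W := fun h => hnot (Or.inr ⟨hf2, h⟩)
      simp [hf1, hf2, hnA, hnW]
    · have hnA : ω ∉ A := fun h => hnot (Or.inl ⟨hf1, h⟩)
      simp [hf1, hf2, hnA]
    · have hnW : ω ∉ W := fun h => hnot (Or.inr ⟨hf2, h⟩)
      simp [hf1, hf2, hnW]
    · simp [hf1, hf2]

omit [DecidableEq V] in
/-- Lemma (P1) for the marks `(a₁, a₃, w)` in `G − o`, middle vertex `a₃`, in the events of `G − o`. -/
lemma oa3w_P1 {p : E → R} (hp : IsProbVec p) {ends : E → Sym2 V} (a₁ a₃ w : V) (f₁ f₂ : E) :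
    prob p (({ω : Config E | Conn ends (Function.update (Function.update ω f₁ false) f₂ false) a₁ a₃}) ∩ ({ω : Config E | Conn ends (Function.update (Function.update ω f₁ false) f₂ false) a₁ w})ᶜ) * prob p (({ω : Config E | Conn ends (Function.update (Function.update ω f₁ false) f₂ false) a₁ a₃})ᶜ ∩ ({ω : Config E | Conn ends (Function.update (Function.update ω f₁ false) f₂ false) a₁ w})ᶜ ∩ ({ω : Config E | Conn ends (Function.update (Function.update ω f₁ false) f₂ false) a₃ w})) ≤ prob p (({ω : Config E | Conn ends (Function.update (Function.update ω f₁ false) f₂ false) a₁ a₃}) ∩ ({ω : Config E | Conn ends (Function.update (Function.update ω f₁ false) f₂ false) a₁ w})) * prob p (({ω : Config E | Conn ends (Function.update (Function.update ω f₁ false) f₂ false) a₁ a₃})ᶜ ∩ ({ω : Config E | Conn ends (Function.update (Function.update ω f₁ false) f₂ false) a₁ w})ᶜ ∩ ({ω : Config E | Conn ends (Function.update (Function.update ω f₁ false) f₂ false) a₃ w})ᶜ) := by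
  set A : Set (Config E) := {ω | Conn ends (Function.update (Function.update ω f₁ false) f₂ false) a₁ a₃} with hAdef
  set W : Set (Config E) := {ω | Conn ends (Function.update (Function.update ω f₁ false) f₂ false) a₁ w} with hWdef
  set Γ : Set (Config E) := {ω | Conn ends (Function.update (Function.update ω f₁ false) f₂ false) a₃ w} with hΓdef
  -- the shift `P_{p[f₁,f₂↦0]}(S) = P_p({ω ∣ ω⁻ ∈ S})`
  have shift : ∀ S : Set (Config E), prob (Function.update (Function.update p f₁ 0) f₂ 0) S
      = prob p {ω | Function.update (Function.update ω f₁ false) f₂ false ∈ S} := by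
    intro S
    rw [prob_update_zero_eq_shift, prob_update_zero_eq_shift]
    rfl
  have hp' : IsProbVec (Function.update (Function.update p f₁ 0) f₂ 0) :=
    (hp.update f₁ le_rfl zero_le_one).update f₂ le_rfl zero_le_one

  have h := partitionThree_lattice hp' ends a₁ a₃ w
  rw [shift, shift, shift, shift] at h
  have e1 : {ω : Config E | Function.update (Function.update ω f₁ false) f₂ false ∈ partABc ends a₁ a₃ w}
      = A ∩ Wᶜ := by
    ext ω
    simp only [partABc, A, W, Set.mem_setOf_eq, Set.mem_inter_iff, Set.mem_compl_iff, mem_connEvent]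
  have e2 : {ω : Config E | Function.update (Function.update ω f₁ false) f₂ false ∈ partBCa ends a₁ a₃ w}
      = Aᶜ ∩ Wᶜ ∩ Γ := by
    ext ω
    simp only [partBCa, A, W, Γ, Set.mem_setOf_eq, Set.mem_inter_iff, Set.mem_compl_iff,
      mem_connEvent]
    constructor
    · rintro ⟨h1, h2⟩; exact ⟨⟨h2, fun hw => h2 (conn_trans hw (conn_symm h1))⟩, h1⟩
    · rintro ⟨⟨h2, _⟩, h1⟩; exact ⟨h1, h2⟩
  have e3 : {ω : Config E | Function.update (Function.update ω f₁ false) f₂ false ∈ partAll ends a₁ a₃ w}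
      = A ∩ W := by
    ext ω
    simp only [partAll, A, W, Set.mem_setOf_eq, Set.mem_inter_iff, mem_connEvent]
    constructor
    · rintro ⟨h1, h2⟩; exact ⟨h1, conn_trans h1 h2⟩
    · rintro ⟨h1, h2⟩; exact ⟨h1, conn_trans (conn_symm h1) h2⟩
  have e4 : {ω : Config E | Function.update (Function.update ω f₁ false) f₂ false ∈ partApart ends a₁ a₃ w}
      = Aᶜ ∩ Wᶜ ∩ Γᶜ := by
    ext ω
    simp only [partApart, A, W, Γ, Set.mem_setOf_eq, Set.mem_inter_iff, Set.mem_compl_iff,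
      mem_connEvent]
  rw [e1, e2, e3, e4] at h
  exact h

omit [DecidableEq V] [IsStrictOrderedRing R] in
/-- The inductive hypothesis — (ZC) under `p[f₁, f₂ ↦ 0]` for the marks `(a₁, a₃, w)` and an up-set
`𝓔₀` — in the events of `G − o`. -/
lemma oa3w_ZC_shift {p : E → R} {ends : E → Sym2 V} (a₁ a₃ w : V) (f₁ f₂ : E) (𝓔₀ : Set (Set V))
    (hZ : let p' := Function.update (Function.update p f₁ 0) f₂ 0
      let e' := connEvent ends a₁ a₃
      let L' := connEvent ends a₁ w
      let U' := clusterInEvent ends a₁ 𝓔₀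
      let γ' := connEvent ends a₃ w
      0 ≤ prob p' (e'ᶜ ∩ L'ᶜ ∩ γ'ᶜ) * (prob p' (U' ∩ (e' ∩ L')) - prob p' U' * prob p' (e' ∩ L'))
        - prob p' (e'ᶜ ∩ L'ᶜ ∩ γ') * (prob p' (U' ∩ (e' ∩ L'ᶜ)) - prob p' U' * prob p' (e' ∩ L'ᶜ))) :
    0 ≤ prob p (({ω : Config E | Conn ends (Function.update (Function.update ω f₁ false) f₂ false) a₁ a₃})ᶜ ∩ ({ω : Config E | Conn ends (Function.update (Function.update ω f₁ false) f₂ false) a₁ w})ᶜ ∩ ({ω : Config E | Conn ends (Function.update (Function.update ω f₁ false) f₂ false) a₃ w})ᶜ) * (prob p (({ω : Config E | cluster ends (Function.update (Function.update ω f₁ false) f₂ false) a₁ ∈ 𝓔₀}) ∩ (({ω : Config E | Conn ends (Function.update (Function.update ω f₁ false) f₂ false) a₁ a₃}) ∩ ({ω : Config E | Conn ends (Function.update (Function.update ω f₁ false) f₂ false) a₁ w}))) - prob p ({ω : Config E | cluster ends (Function.update (Function.update ω f₁ false) f₂ false) a₁ ∈ 𝓔₀}) * prob p (({ω : Config E |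 Conn ends (Function.update (Function.update ω f₁ false) f₂ false) a₁ a₃}) ∩ ({ω : Config E | Conn ends (Function.update (Function.update ω f₁ false) f₂ false) a₁ w})))
      - prob p (({ω : Config E | Conn ends (Function.update (Function.update ω f₁ false) f₂ false) a₁ a₃})ᶜ ∩ ({ω : Config E | Conn ends (Function.update (Function.update ω f₁ false) f₂ false) a₁ w})ᶜ ∩ ({ω : Config E | Conn ends (Function.update (Function.update ω f₁ false) f₂ false) a₃ w})) * (prob p (({ω : Config E | cluster ends (Function.update (Function.update ω f₁ false) f₂ false) a₁ ∈ 𝓔₀}) ∩ (({ω : Config E | Conn ends (Function.update (Function.update ω f₁ false) f₂ false) a₁ a₃}) ∩ ({ω : Config E | Conn ends (Function.update (Function.update ω f₁ false) f₂ false) a₁ w})ᶜ)) - prob p ({ω : Config E | cluster ends (Function.update (Function.update ω f₁ false) f₂ false) a₁ ∈ 𝓔₀}) * prob p (({ω : Config E | Conn ends (Function.update (Function.update ω f₁ false) f₂ false) a₁ a₃}) ∩ ({ω : Config E | Conn ends (Function.update (Function.update ω f₁ false) f₂ false) a₁ w})ᶜ)) := by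
  simp only at hZ
  set A : Set (Config E) := {ω | Conn ends (Function.update (Function.update ω f₁ false) f₂ false) a₁ a₃} with hAdef
  set W : Set (Config E) := {ω | Conn ends (Function.update (Function.update ω f₁ false) f₂ false) a₁ w} with hWdef
  set Γ : Set (Config E) := {ω | Conn ends (Function.update (Function.update ω f₁ false) f₂ false) a₃ w} with hΓdef
  set XE : Set (Config E) := {ω | cluster ends (Function.update (Function.update ω f₁ false) f₂ false) a₁ ∈ 𝓔₀} with hXEdef
  -- the shift `P_{p[f₁,f₂↦0]}(S) = P_p({ω ∣ ω⁻ ∈ S})`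
  have shift : ∀ S : Set (Config E), prob (Function.update (Function.update p f₁ 0) f₂ 0) S
      = prob p {ω | Function.update (Function.update ω f₁ false) f₂ false ∈ S} := by
    intro S
    rw [prob_update_zero_eq_shift, prob_update_zero_eq_shift]
    rfl

  simp only [shift] at hZ
  have s1 : {ω : Config E | Function.update (Function.update ω f₁ false) f₂ false ∈
      (connEvent ends a₁ a₃)ᶜ ∩ (connEvent ends a₁ w)ᶜ ∩ (connEvent ends a₃ w)ᶜ} = Aᶜ ∩ Wᶜ ∩ Γᶜ := by
    ext ω; simp only [A, W, Γ, Set.mem_setOf_eq, Set.mem_inter_iff, Set.mem_compl_iff, mem_connEvent]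
  have s2 : {ω : Config E | Function.update (Function.update ω f₁ false) f₂ false ∈
      clusterInEvent ends a₁ 𝓔₀ ∩ (connEvent ends a₁ a₃ ∩ connEvent ends a₁ w)} = XE ∩ (A ∩ W) := by
    ext ω
    simp only [XE, A, W, Set.mem_setOf_eq, Set.mem_inter_iff, mem_connEvent, mem_clusterInEvent]
  have s3 : {ω : Config E | Function.update (Function.update ω f₁ false) f₂ false ∈
      clusterInEvent ends a₁ 𝓔₀} = XE := by
    ext ω
    simp only [XE, Set.mem_setOf_eq, mem_clusterInEvent]
  have s4 : {ω : Config E | Function.update (Function.update ω f₁ false) f₂ false ∈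
      connEvent ends a₁ a₃ ∩ connEvent ends a₁ w} = A ∩ W := by
    ext ω; simp only [A, W, Set.mem_setOf_eq, Set.mem_inter_iff, mem_connEvent]
  have s5 : {ω : Config E | Function.update (Function.update ω f₁ false) f₂ false ∈
      (connEvent ends a₁ a₃)ᶜ ∩ (connEvent ends a₁ w)ᶜ ∩ connEvent ends a₃ w} = Aᶜ ∩ Wᶜ ∩ Γ := by
    ext ω; simp only [A, W, Γ, Set.mem_setOf_eq, Set.mem_inter_iff, Set.mem_compl_iff, mem_connEvent]
  have s6 : {ω : Config E | Function.update (Function.update ω f₁ false) f₂ false ∈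
      clusterInEvent ends a₁ 𝓔₀ ∩ (connEvent ends a₁ a₃ ∩ (connEvent ends a₁ w)ᶜ)}
      = XE ∩ (A ∩ Wᶜ) := by
    ext ω
    simp only [XE, A, W, Set.mem_setOf_eq, Set.mem_inter_iff, Set.mem_compl_iff, mem_connEvent,
      mem_clusterInEvent]
  have s7 : {ω : Config E | Function.update (Function.update ω f₁ false) f₂ false ∈
      connEvent ends a₁ a₃ ∩ (connEvent ends a₁ w)ᶜ} = A ∩ Wᶜ := by
    ext ω; simp only [A, W, Set.mem_setOf_eq, Set.mem_inter_iff, Set.mem_compl_iff, mem_connEvent]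
  rw [s1, s2, s3, s4, s5, s6, s7] at hZ
  exact hZ

/-- BHK06 avoidance for the root `a₁` avoiding `{a₃}`, with the outside connection `a₃ ↔ w`
(`bhk_inside_outside_avoid` under `p[f₁, f₂ ↦ 0]`), in the events of `G − o`. -/
lemma oa3w_NA_single [Fintype V] {p : E → R} (hp : IsProbVec p) {ends : E → Sym2 V} (a₁ a₃ w : V)
    (f₁ f₂ : E) {𝓔 : Set (Set V)} (h𝓔 : IsUpperSet 𝓔) :
    prob p (({ω : Config E | cluster ends (Function.update (Function.update ω f₁ false) f₂ false) a₁ ∈ 𝓔}) ∩ (({ω : Config E | Conn ends (Function.update (Function.update ω f₁ false) f₂ false) a₁ a₃})ᶜ ∩ ({ω : Config E | Conn ends (Function.update (Function.update ω f₁ false) f₂ false) a₁ w})ᶜ ∩ ({ω : Config E | Conn ends (Function.update (Function.update ω f₁ false) f₂ false) a₃ w}))) * prob p ({ω : Config E | Conn ends (Function.update (Function.update ω f₁ false) f₂ false) a₁ a₃})ᶜ ≤ prob p (({ω : Config E | cluster ends (Function.update (Function.update ω f₁ false) f₂ false) a₁ ∈ 𝓔}) ∩ ({ω : Config E | Conn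 ends (Function.update (Function.update ω f₁ false) f₂ false) a₁ a₃})ᶜ) * prob p (({ω : Config E | Conn ends (Function.update (Function.update ω f₁ false) f₂ false) a₁ a₃})ᶜ ∩ ({ω : Config E | Conn ends (Function.update (Function.update ω f₁ false) f₂ false) a₁ w})ᶜ ∩ ({ω : Config E | Conn ends (Function.update (Function.update ω f₁ false) f₂ false) a₃ w})) := by
  set A : Set (Config E) := {ω | Conn ends (Function.update (Function.update ω f₁ false) f₂ false) a₁ a₃} with hAdef
  set W : Set (Config E) := {ω | Conn ends (Function.update (Function.update ω f₁ false) f₂ false) a₁ w} with hWdef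
  set Γ : Set (Config E) := {ω | Conn ends (Function.update (Function.update ω f₁ false) f₂ false) a₃ w} with hΓdef
  set X₀ : Set (Config E) := {ω | cluster ends (Function.update (Function.update ω f₁ false) f₂ false) a₁ ∈ 𝓔} with hX₀def
  -- the shift `P_{p[f₁,f₂↦0]}(S) = P_p({ω ∣ ω⁻ ∈ S})`
  have shift : ∀ S : Set (Config E), prob (Function.update (Function.update p f₁ 0) f₂ 0) S
      = prob p {ω | Function.update (Function.update ω f₁ false) f₂ false ∈ S} := by
    intro S
    rw [prob_update_zero_eq_shift, prob_update_zero_eq_shift]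
    rfl
  have hp' : IsProbVec (Function.update (Function.update p f₁ 0) f₂ 0) :=
    (hp.update f₁ le_rfl zero_le_one).update f₂ le_rfl zero_le_one
  have h𝓥 : IsUpperSet ({T : Set V | a₃ ∈ T}) := fun T T' hle hT => hle hT
  have hav1 : {ω : Config E | Function.update (Function.update ω f₁ false) f₂ false ∈
      avoidAll ends a₁ {a₃}} = Aᶜ := by
    ext ω; simp only [A, Set.mem_setOf_eq, Set.mem_compl_iff, mem_avoidAll, Finset.mem_singleton,
      forall_eq]
  have hav2 : {ω : Config E | Function.update (Function.update ω f₁ false) f₂ false ∈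
      avoidAll ends a₁ (insert w {a₃})} = Aᶜ ∩ Wᶜ := by
    ext ω; simp only [A, W, Set.mem_setOf_eq, Set.mem_inter_iff, Set.mem_compl_iff, mem_avoidAll,
      Finset.mem_insert, Finset.mem_singleton, forall_eq_or_imp, forall_eq]
    tauto
  have hav3 : {ω : Config E | Function.update (Function.update ω f₁ false) f₂ false ∈
      avoidAll ends a₁ (insert a₃ {w})} = Aᶜ ∩ Wᶜ := by
    ext ω; simp only [A, W, Set.mem_setOf_eq, Set.mem_inter_iff, Set.mem_compl_iff, mem_avoidAll,
      Finset.mem_insert, Finset.mem_singleton, forall_eq_or_imp, forall_eq]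

  have h := bhk_inside_outside_avoid (Function.update (Function.update p f₁ 0) f₂ 0) hp' ends a₁ w
    {a₃} h𝓔 h𝓥
  rw [shift, shift, shift, shift] at h
  have s1 : {ω : Config E | Function.update (Function.update ω f₁ false) f₂ false ∈
      clusterInEvent ends a₁ 𝓔 ∩ clusterInEvent ends w {T | a₃ ∈ T} ∩ avoidAll ends a₁ (insert w {a₃})}
      = X₀ ∩ (Aᶜ ∩ Wᶜ ∩ Γ) := by
    ext ω
    simp only [X₀, A, W, Γ, Set.mem_setOf_eq, Set.mem_inter_iff, Set.mem_compl_iff, mem_avoidAll,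
      mem_clusterInEvent, mem_cluster, Finset.mem_insert, Finset.mem_singleton, forall_eq_or_imp,
      forall_eq]
    constructor
    · rintro ⟨⟨h0, hc⟩, hw', h3'⟩; exact ⟨h0, ⟨h3', hw'⟩, conn_symm hc⟩
    · rintro ⟨h0, ⟨h3', hw'⟩, hc⟩; exact ⟨⟨h0, conn_symm hc⟩, hw', h3'⟩
  have s2 : {ω : Config E | Function.update (Function.update ω f₁ false) f₂ false ∈
      clusterInEvent ends a₁ 𝓔 ∩ avoidAll ends a₁ {a₃}} = X₀ ∩ Aᶜ := by
    ext ω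
    simp only [X₀, A, Set.mem_setOf_eq, Set.mem_inter_iff, Set.mem_compl_iff, mem_avoidAll,
      mem_clusterInEvent, Finset.mem_singleton, forall_eq]
  have s3 : {ω : Config E | Function.update (Function.update ω f₁ false) f₂ false ∈
      clusterInEvent ends w {T | a₃ ∈ T} ∩ avoidAll ends a₁ (insert w {a₃})} = Aᶜ ∩ Wᶜ ∩ Γ := by
    ext ω
    simp only [A, W, Γ, Set.mem_setOf_eq, Set.mem_inter_iff, Set.mem_compl_iff, mem_avoidAll,
      mem_clusterInEvent, mem_cluster, Finset.mem_insert, Finset.mem_singleton, forall_eq_or_imp,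
      forall_eq]
    constructor
    · rintro ⟨hc, hw', h3'⟩; exact ⟨⟨h3', hw'⟩, conn_symm hc⟩
    · rintro ⟨⟨h3', hw'⟩, hc⟩; exact ⟨conn_symm hc, hw', h3'⟩
  rw [s1, hav1, s2, s3] at h
  exact h

/-- BHK06 avoidance for the root `a₁` avoiding `{a₃, w}`, with the outside connection `a₃ ↔ w`, for
any up-set `𝓔₀`, in the events of `G − o`. -/
lemma oa3w_NA_two [Fintype V] {p : E → R} (hp : IsProbVec p) {ends : E → Sym2 V} (a₁ a₃ w : V)
    (f₁ f₂ : E) (𝓔₀ : Set (Set V)) (h𝓔₀ : IsUpperSet 𝓔₀) :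
    prob p ({ω | cluster ends (Function.update (Function.update ω f₁ false) f₂ false) a₁ ∈ 𝓔₀}
        ∩ (({ω : Config E | Conn ends (Function.update (Function.update ω f₁ false) f₂ false) a₁ a₃})ᶜ ∩ ({ω : Config E | Conn ends (Function.update (Function.update ω f₁ false) f₂ false) a₁ w})ᶜ ∩ ({ω : Config E | Conn ends (Function.update (Function.update ω f₁ false) f₂ false) a₃ w}))) * prob p (({ω : Config E | Conn ends (Function.update (Function.update ω f₁ false) f₂ false) a₁ a₃})ᶜ ∩ ({ω : Config E | Conn ends (Function.update (Function.update ω f₁ false) f₂ false) a₁ w})ᶜ)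
      ≤ prob p ({ω | cluster ends (Function.update (Function.update ω f₁ false) f₂ false) a₁ ∈ 𝓔₀}
        ∩ (({ω : Config E | Conn ends (Function.update (Function.update ω f₁ false) f₂ false) a₁ a₃})ᶜ ∩ ({ω : Config E | Conn ends (Function.update (Function.update ω f₁ false) f₂ false) a₁ w})ᶜ)) * prob p (({ω : Config E | Conn ends (Function.update (Function.update ω f₁ false) f₂ false) a₁ a₃})ᶜ ∩ ({ω : Config E | Conn ends (Function.update (Function.update ω f₁ false) f₂ false) a₁ w})ᶜ ∩ ({ω : Config E | Conn ends (Function.update (Function.update ω f₁ false) f₂ false) a₃ w})) := by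
  set A : Set (Config E) := {ω | Conn ends (Function.update (Function.update ω f₁ false) f₂ false) a₁ a₃} with hAdef
  set W : Set (Config E) := {ω | Conn ends (Function.update (Function.update ω f₁ false) f₂ false) a₁ w} with hWdef
  set Γ : Set (Config E) := {ω | Conn ends (Function.update (Function.update ω f₁ false) f₂ false) a₃ w} with hΓdef
  -- the shift `P_{p[f₁,f₂↦0]}(S) = P_p({ω ∣ ω⁻ ∈ S})`
  have shift : ∀ S : Set (Config E), prob (Function.update (Function.update p f₁ 0) f₂ 0) S
      = prob p {ω | Function.update (Function.update ω f₁ false) f₂ false ∈ S} := by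
    intro S
    rw [prob_update_zero_eq_shift, prob_update_zero_eq_shift]
    rfl
  have hp' : IsProbVec (Function.update (Function.update p f₁ 0) f₂ 0) :=
    (hp.update f₁ le_rfl zero_le_one).update f₂ le_rfl zero_le_one
  have h𝓥' : IsUpperSet ({T : Set V | w ∈ T}) := fun T T' hle hT => hle hT
  have hav3 : {ω : Config E | Function.update (Function.update ω f₁ false) f₂ false ∈
      avoidAll ends a₁ (insert a₃ {w})} = Aᶜ ∩ Wᶜ := by
    ext ω; simp only [A, W, Set.mem_setOf_eq, Set.mem_inter_iff, Set.mem_compl_iff, mem_avoidAll,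
      Finset.mem_insert, Finset.mem_singleton, forall_eq_or_imp, forall_eq]
  have h := bhk_inside_outside_avoid (Function.update (Function.update p f₁ 0) f₂ 0) hp' ends a₁ a₃
    (insert a₃ {w}) h𝓔₀ h𝓥'
  rw [Finset.insert_eq_of_mem (Finset.mem_insert_self a₃ {w})] at h
  rw [shift, shift, shift, shift] at h
  have s1 : {ω : Config E | Function.update (Function.update ω f₁ false) f₂ false ∈
      clusterInEvent ends a₁ 𝓔₀ ∩ clusterInEvent ends a₃ {T | w ∈ T} ∩ avoidAll ends a₁ (insert a₃ {w})}
      = {ω | cluster ends (Function.update (Function.update ω f₁ false) f₂ false) a₁ ∈ 𝓔₀}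
        ∩ (Aᶜ ∩ Wᶜ ∩ Γ) := by
    ext ω
    simp only [A, W, Γ, Set.mem_setOf_eq, Set.mem_inter_iff, Set.mem_compl_iff, mem_avoidAll,
      mem_clusterInEvent, mem_cluster, Finset.mem_insert, Finset.mem_singleton, forall_eq_or_imp,
      forall_eq]
    tauto
  have s2 : {ω : Config E | Function.update (Function.update ω f₁ false) f₂ false ∈
      clusterInEvent ends a₁ 𝓔₀ ∩ avoidAll ends a₁ (insert a₃ {w})}
      = {ω | cluster ends (Function.update (Function.update ω f₁ false) f₂ false) a₁ ∈ 𝓔₀}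
        ∩ (Aᶜ ∩ Wᶜ) := by
    ext ω
    simp only [A, W, Set.mem_setOf_eq, Set.mem_inter_iff, Set.mem_compl_iff, mem_avoidAll,
      mem_clusterInEvent, Finset.mem_insert, Finset.mem_singleton, forall_eq_or_imp, forall_eq]
  have s3 : {ω : Config E | Function.update (Function.update ω f₁ false) f₂ false ∈
      clusterInEvent ends a₃ {T | w ∈ T} ∩ avoidAll ends a₁ (insert a₃ {w})} = Aᶜ ∩ Wᶜ ∩ Γ := by
    ext ω
    simp only [A, W, Γ, Set.mem_setOf_eq, Set.mem_inter_iff, Set.mem_compl_iff, mem_avoidAll,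
      mem_clusterInEvent, mem_cluster, Finset.mem_insert, Finset.mem_singleton, forall_eq_or_imp,
      forall_eq]
    tauto
  rw [s1, s2, s3, hav3] at h
  exact h

end GraphTheoremIAux

end Summit.Ventures.PercRepro2
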